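import Mathlib
import HarnessLib
import Summits.HubbardSuperconductivity.HubbardSuperconductivity.Theorems.KLProgrammeKLRegimeVolumeLimitV11HcovOfTowerP
import Summits.HubbardSuperconductivity.HubbardSuperconductivity.Theorems.KLProgrammeKLRegimeVolumeLimitV11TowerDataWOfThreeAtoms
import Summits.HubbardSuperconductivity.HubbardSuperconductivity.Theorems.KLProgrammeKLRegimeVolumeLimitV11HB1WOfGridM

/-!
# Route `KLProgramme` — crux K3, VL child (stmt-HubbardSuperconductivity-20440), window key «(VL)-SRC-WINDOW» (pen (R235)):
# `stub_vl_towerData` (v12W: `∃ t ∈ (0,1], Nonempty (TowerDataTSW β U μ t)`, binder `R.WF2`) FROM THREE ATOMS — HE1 ⊕ Hmis ⊕ Hgrid‴ ⊕ producer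
# (seat hubbard-kl-k3c4-p1 g17; `…V11TowerDataWOfThreeAtoms.stub_vl_towerDataW_WF2_of_threeAtoms` (p655104) with HB1W := `hB1W_of_gridM Hgrid‴`)

The INTERFACE OF RECORD under the window key: the VL data stub is discharged by the E1 lineage's `HE1` (partition functions + alive read-out, one volume),
k3c4-p2's `Hmis` (frame-mismatch rates of the step covariances and tower transfers) and p3 g18's `Hgrid‴` (`Nonempty (TowerGridDataM …)` eventually, with its
constants, four `θ < 1` and rates — the grid half of the base), plus the producer's `SourceProfilesAtLev` text; the base's transfer half and `Hcov` are theorems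
(`hbaseW_of_towerP`, `hcov_of_towerP`).
* **`stub_vl_towerDataW_WF2_of_gridM`**.

Proofs only; no definition; nothing asserts HE1, Hmis, Hgrid‴, the producer, any stub, K3, VL or superconductivity.
[cite: BenfattoGiulianiMastropietro2006, §2.7-§2.9 and §3]
-/

noncomputable section

namespace Summit.HubbardSuperconductivity.HubbardSuperconductivity.Theorems.TwoVolumeSource

set_option linter.dupNamespace false -- summit = problem name (single-conjunct summit), D-0017

open Finset Filter Topology Literature.MathematicalPhysics.QuantumLattice GrassmannAlgebra Literature.Probability.LatticeModels
  Literature.Probability.LatticeModels.BattleFederbush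
open Summit.HubbardSuperconductivity.HubbardSuperconductivity.Theorems.KLRegimeSplit
open Summit.HubbardSuperconductivity.HubbardSuperconductivity.Theorems.KLProgrammeLegKernels
open Summit.HubbardSuperconductivity.HubbardSuperconductivity.Theorems.TwoPointAssembly
open Summit.HubbardSuperconductivity.HubbardSuperconductivity.Theorems.EngineV8
open Summit.HubbardSuperconductivity.HubbardSuperconductivity.Theorems.TwoVolumeDefect
open Summit.HubbardSuperconductivity.HubbardSuperconductivity.Theorems.TorusFourierL2

set_option maxHeartbeats 1600000 in -- long binders
/-- **`stub_vl_towerData` (v12W) FROM `HE1`, `Hmis`, p3's GRID ATOM `Hgrid‴` AND THE PRODUCER TEXT** — `HB1W` discharged by `hB1W_of_gridM`.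
[folklore: composition; cite: BenfattoGiulianiMastropietro2006, §2.7-§2.9 and §3] -/
theorem stub_vl_towerDataW_WF2_of_gridM
    (HE1 : ∀ (G : GeoConsts) (P : SplitConsts) (Q : EngConsts) (R : RenConsts), G.WF → P.WF → Q.WF → R.WF2 →
      ∃ C₀ : ℝ, 0 ≤ C₀ ∧
        ∃ c₇ : ℝ, 0 < c₇ ∧ ∀ c : ℝ, 0 < c → c ≤ c₇ → ∃ U₇ : ℝ, 0 < U₇ ∧
          ∀ μ ∈ klWindowC, ∀ U : ℝ, 0 < U → U ≤ U₇ → ∀ β : ℝ, klBetaMin ≤ β → β ≤ Real.exp (c / U ^ 2) →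
            ∀ (K : TrigPolyC4v) (Lstar : ℕ) (Mstar : ℕ → ℕ), TowerP klPredsV17F2 G P Q R β U μ K Lstar Mstar →
            ∃ S₀ : ℕ → ℕ → ℝ, (∀ j m, 0 ≤ S₀ j m) ∧ (∀ j, j ≤ nScales β → ∀ m, 1 ≤ m → S₀ j (2 * m) ≤ C₀ * klWtBudget P Q U (j + 1) (2 * m)) ∧
            ∃ L₂ : ℕ, ∃ M₂ : ℕ → ℕ, ∀ (L M : ℕ) [NeZero L] [NeZero M], L₂ ≤ L → M₂ L ≤ M →
              (∀ k, k ≤ nScales β → hubbardEffPartitionFnCT L M β U μ 0 (klFlowFrameU L M β U μ (nScales β + 1)) (klScale klE0 (k + 1)) ≠ 0) ∧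
              (∀ j, j ≤ nScales β → ∀ (m : ℕ) (q : Fin m) (w : SpaceTimeIdx L M × SectorLeg (sectorCount j)),
                klWtPinnedSumAt L M β μ (klFlowFrameU L M β U μ (nScales β + 1)) j j m (klEffectiveAction L M β U μ (klFlowFrameU L M β U μ (nScales β + 1)) klE0 (j + 1)) q w ≤ S₀ j m))
    (Hmis : ∀ (G : GeoConsts) (P : SplitConsts) (Q : EngConsts) (R : RenConsts), G.WF → P.WF → Q.WF → R.WF2 →
        ∃ c₇ : ℝ, 0 < c₇ ∧ ∀ c : ℝ, 0 < c → c ≤ c₇ → ∃ U₇ : ℝ, 0 < U₇ ∧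
          ∀ μ ∈ klWindowC, ∀ U : ℝ, 0 < U → U ≤ U₇ → ∀ β : ℝ, klBetaMin ≤ β → β ≤ Real.exp (c / U ^ 2) →
            ∀ (K : TrigPolyC4v) (Lstar : ℕ) (Mstar : ℕ → ℕ), TowerP klPredsV17F2 G P Q R β U μ K Lstar Mstar →
            ∃ (sE cR cC δ : ℕ → ℕ → ℝ),
              (∀ j L, 0 ≤ sE j L ∧ 0 ≤ cR j L ∧ 0 ≤ cC j L ∧ 0 ≤ δ j L ∧ cR j L ≤ 1 ∧ cC j L ≤ 1 ∧ δ j L ≤ 1) ∧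
              (∀ j, Tendsto (sE j) atTop (𝓝 0) ∧ Tendsto (cR j) atTop (𝓝 0) ∧ Tendsto (cC j) atTop (𝓝 0) ∧ Tendsto (δ j) atTop (𝓝 0)) ∧
            ∃ L₂ : ℕ, ∃ M₂ : ℕ → ℕ → ℕ, ∀ (L b M : ℕ) [NeZero L] [NeZero (b * L)] [NeZero M], L₂ ≤ L → M₂ L b ≤ M →
              (∀ j, j < nScales β → ∀ x y, ‖(klStepCov (b * L) M β μ (klFlowFrameU (b * L) M β U μ (nScales β + 1)) j - klStepCov (b * L) M β μ (klFlowFrameU L M β U μ (nScales β + 1)) j) x y‖ ≤ sE j L) ∧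
              (∀ j, j < nScales β → ∀ x, ∑ y, ‖(klStepCov (b * L) M β μ (klFlowFrameU (b * L) M β U μ (nScales β + 1)) j - klStepCov (b * L) M β μ (klFlowFrameU L M β U μ (nScales β + 1)) j) x y‖ ≤
                cR j L / imagTimeWeight β M) ∧
              (∀ j, j < nScales β → ∀ y, ∑ x, ‖(klStepCov (b * L) M β μ (klFlowFrameU (b * L) M β U μ (nScales β + 1)) j - klStepCov (b * L) M β μ (klFlowFrameU L M β U μ (nScales β + 1)) j) x y‖ ≤
                cC j L / imagTimeWeight β M) ∧
              (∀ j, j ≤ nScales β → ∀ x, ∑ y, ‖klTowerTransfer (b * L) M β μ (klFlowFrameU (b * L) M β U μ (nScales β + 1)) j x y - klTowerTransfer (b * L) M β μ (klFlowFrameU L M β U μ (nScales β + 1)) j x y‖ ≤ δ j L) ∧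
              (∀ j, j ≤ nScales β → ∀ y, ∑ x, ‖klTowerTransfer (b * L) M β μ (klFlowFrameU (b * L) M β U μ (nScales β + 1)) j x y - klTowerTransfer (b * L) M β μ (klFlowFrameU L M β U μ (nScales β + 1)) j x y‖ ≤ δ j L))
    (HgridM : ∀ (G : GeoConsts) (P : SplitConsts) (Q : EngConsts) (R : RenConsts), G.WF → P.WF → Q.WF → R.WF2 →
        ∃ c₇ : ℝ, 0 < c₇ ∧ ∀ c : ℝ, 0 < c → c ≤ c₇ → ∃ U₇ : ℝ, 0 < U₇ ∧
          ∀ μ ∈ klWindowC, ∀ U : ℝ, 0 < U → U ≤ U₇ → ∀ β : ℝ, klBetaMin ≤ β → β ≤ Real.exp (c / U ^ 2) →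
            ∀ (K : TrigPolyC4v) (Lstar : ℕ) (Mstar : ℕ → ℕ), TowerP klPredsV17F2 G P Q R β U μ K Lstar Mstar →
            ∃ (κE aC cb κg κg' ρS ρg' ρg₂ ρgf aw al al' mo mo' s s' Θ νW νf νg₂ νD : ℝ) (sgE cc eE tT Te : ℕ → ℝ),
              (0 < κE ∧ 0 < aC ∧ 0 < κg ∧ 0 < κg' ∧ 0 < ρS ∧ 0 < ρg' ∧ 0 < ρg₂ ∧ 0 < ρgf ∧ 0 < aw ∧ 0 < al' + al ∧ 0 ≤ mo ∧ 0 ≤ mo' ∧ 0 ≤ s ∧ 0 ≤ s' ∧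
                0 ≤ Θ ∧ 0 ≤ νW ∧ 0 ≤ νf ∧ 0 ≤ νg₂) ∧
              (Real.exp 1 * (aC + cb) * νW / κE ^ 2 < 1 ∧ Real.exp 1 * aw * Θ / κg' ^ 2 < 1 ∧
                Real.exp 1 * (al' + al + (mo' + mo)) * νf / (κg' + κg) ^ 2 < 1 ∧
                Real.exp 1 * (al' + al + (mo' + mo)) * νg₂ / (κg' + κg + (κg' + κg + (κg' + κg))) ^ 2 < 1) ∧
              (∀ L, 0 ≤ sgE L ∧ 0 ≤ cc L ∧ 2 * cc L ≤ cb ∧ 0 < tT L ∧ 0 ≤ Te L) ∧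
              (Tendsto sgE atTop (𝓝 0) ∧ Tendsto cc atTop (𝓝 0) ∧ Tendsto eE atTop (𝓝 0) ∧ Tendsto tT atTop (𝓝 0) ∧ Tendsto Te atTop (𝓝 0)) ∧
            ∃ L₂ : ℕ, ∃ M₂ : ℕ → ℕ → ℕ, ∀ (L b M : ℕ) [NeZero L] [NeZero (b * L)] [NeZero M], L₂ ≤ L → M₂ L b ≤ M →
              Nonempty (TowerGridDataM L b M β U μ (klFlowFrameU L M β U μ (nScales β + 1)) (klFlowFrameU (b * L) M β U μ (nScales β + 1)) (imagTimeWeight β M)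
                κE aC κg κg' ρS ρg' ρg₂ ρgf aw al al' mo mo' s s' Θ νW νf νg₂ νD
                (sgE L) (cc L) (eE L) (tT L) (Te L) (Nat.sqrt (L / (4 * nScales β + 7))) ((L / (4 * nScales β + 7)) - Nat.sqrt (L / (4 * nScales β + 7)))))
    (hSrc : ∀ (P : SplitConsts) (R : RenConsts), P.WF → R.WF2 →
      ∃ Q' : EngConsts, 0 ≤ Q'.CE ∧ ∃ c₀ : ℝ, 0 < c₀ ∧ ∀ c : ℝ, 0 < c → c ≤ c₀ → ∃ U₀ : ℝ, 0 < U₀ ∧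
        ∀ μ ∈ klWindowC, ∀ U : ℝ, 0 < U → U ≤ U₀ → ∀ β : ℝ, klBetaMin ≤ β → β ≤ Real.exp (c / U ^ 2) →
          ∃ A : ℕ → ℕ → ℝ, ∃ L₁ : ℕ, ∃ M₁ : ℕ → ℕ, ∀ (L M : ℕ) [NeZero L] [NeZero M], L₁ ≤ L → M₁ L ≤ M →
            ∀ j : ℕ, j + 1 ≤ nScales β + 1 →
              SourceProfilesAtLev L M (klSrcBudget P Q' U A (j + 1)) β U μ (klFlowFrameU L M β U μ (nScales β + 1)) j j (j + 1))
    (G : GeoConsts) (P : SplitConsts) (Q : EngConsts) (R : RenConsts) (hG : G.WF) (hP : P.WF) (hQ : Q.WF) (hR2 : R.WF2) :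
    ∃ c₅ : ℝ, 0 < c₅ ∧ ∀ c : ℝ, 0 < c → c ≤ c₅ → ∃ U₀ : ℝ, 0 < U₀ ∧
      ∀ μ ∈ klWindowC, ∀ U : ℝ, 0 < U → U ≤ U₀ → ∀ β : ℝ, klBetaMin ≤ β → β ≤ Real.exp (c / U ^ 2) →
        ∀ K : TrigPolyC4v, klPredsV17F2.frameOK R U (nScales β) μ K →
          ∀ (Lstar : ℕ) (Mstar : ℕ → ℕ), TowerP klPredsV17F2 G P Q R β U μ K Lstar Mstar →
            ∃ t : ℝ, 0 < t ∧ t ≤ 1 ∧ Nonempty (TowerDataTSW β U μ t) :=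
  stub_vl_towerDataW_WF2_of_threeAtoms HE1 Hmis (fun G P Q R hG hP hQ hR2 => hB1W_of_gridM HgridM G P Q R hG hP hQ hR2) hSrc G P Q R hG hP hQ hR2

end Summit.HubbardSuperconductivity.HubbardSuperconductivity.Theorems.TwoVolumeSource

end
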